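import Literature.MathematicalPhysics.QuantumFieldTheory.Balaban1983to89.B9Eq326ConjugatedLocalPart
import Literature.MathematicalPhysics.QuantumFieldTheory.Balaban1983to89.B9Eq349ConjugatedGreenBlockDecay

/-!
# `Balaban1983to89.B9Eq326LocalPartBlockDecay` — T. Bałaban, *Propagators for lattice gauge theories in a background field*, Commun. Math. Phys. **99**
# (1985) 389–434 [Balaban1985BackgroundPropagators] (3.26) p. 395, Thm 3.11 p. 416 *«… the kernels … decay exponentially»*, (3.49) p. 399:
# **THE `L²` BLOCK DECAY OF THE INVERSE OF THE LOCAL PART — `‖P_{y₁} ∘ A₀⁻¹ ∘ P_{y₀}‖ ≤ (4∕γ)·e^{r}·e^{−r·d_m(y₀,y₁)}`** for the bond-field blocks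
# `P_y` (bonds based in the block `B(y)`) of the one-step torus, from the circle form of `B9Eq326ConjugatedLocalPart.norm_conjLocalInv_le` and the
# Cauchy ∕ Combes–Thomas kernel `B9Eq3101CommutatorCauchyBlockDecay.norm_block_le_of_conj_bound_abs` — stone (D0-d) of the NE9 owner's plan v11: the
# (D-E)-type letter of `A₀⁻¹` that the Woodbury route to `G₁` (the entries of the Schur complement `S = Q′G′(1 − D*A₀⁻¹D)G′Q′*`) consumes

statement-level skeleton of published theorems with citation tags; proofs where landed; nothing here is a claim about the Yang–Mills mass gap

CITATION HEADER (lean-in-tree rule).  Audit cell `pub-balaban`, sub-cell `t4`, BINDER row NE9; filed by the NE9 BINDER-row OWNER lineage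
`b2b-balaban-t4-ne9-p1` (gen 92).  Imports this lineage's `B9Eq326ConjugatedLocalPart` ((D0-c)) and road B8″'s `B9Eq349ConjugatedGreenBlockDecay` (for its
imports BY NAME: (G) `B9Eq3101ExpPointwiseMultiplier.equiv_exp_smul_apply_complex`, (A) `B9Eq3101CommutatorCauchyBlockDecay.norm_block_le_of_conj_bound_abs`,
(K1) `B9Eq349BlockMultipliers`, (K2) `B9Eq349BlockDistanceWeight.exists_pairWeight`, (D) `B9Eq387IMSLocalLettersLattice.exists_pointwise_clm` — the SAME
bricks that gave `exists_block_decay_Gp` for `G′(U)`).  Sources READ first-hand (`paper:balaban1985-cmp99-background-propagators`): p. 395 (3.26), p. 416 Thm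
3.11, p. 399 (3.49).  Print's road is the random walk of Sect. C; the conjugation is the ROUTE's Combes–Thomas substitute; nothing of print's rate is asserted.

WHAT IS PROVED (sorry-free; proof lane — no `def`; [folklore] composition BY NAME).
* §1 **`norm_conjLocalInv_le_of_circle`** (any periodic `Pd`) — for multiplier CLMs `M_B` (bonds, symbol `χ(b₋)`), `M_P` (plaquettes, `χ(p₀)`), `M_S`
  (sites, `χ(x)`) and every `κ` on the circle `‖κ‖ = r`: `‖exp(κ•M_B) ∘ A₀⁻¹ ∘ exp(−κ•M_B)‖ ≤ 4∕γ`, the letters of (D0-c) taken at `S^{±} := exp(±κ•M_·)`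
  ((G) gives their pointwise action), radius windows `rℓη ≤ 1`, `4rℓM_φM_φ′d√d ≤ β`, `4rℓM_φM_φ′d ≤ β`, `2rℓM_φM_φ′√d ≤ β`; the conjugated `Q` and `Δ′`
  letters DISPLAYED at each `κ` of the circle.
* §2 **`norm_block_le_exp_of_uniform_circle_bound_bonds`** (one-step torus `fineP L m`) — bonds → bonds twin of road B8″'s `…_sites`: a circle letter
  uniform over site weights with bond increments `≤ ι` (`1∕L ≤ ι`) for `T : BondL2K →L BondL2K` and the bond blocks `P_y` (`π(b) = blockCoord(b₋)`) ⟹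
  `‖P_{y₁} ∘ T ∘ P_{y₀}‖ ≤ C·e^{r}·e^{−r·d_m(y₀,y₁)}`.
* §3 **`norm_block_localInv_le`** — THE INSTANCE at `A₀⁻¹` on the one-step torus at the diagonal `ηL = 1` (`1 ≤ ℓ`): for every background of the letters
  (`U(b) ∈ U1`, mutually adjoint transports), with the `γ`-coercivity of `A₀`, the `Δ′` floor `p_K`, and the conjugated `Q`∕`Δ′` letters supplied
  UNIFORMLY over the weights and the circle (displayed), `‖P_{y₁} ∘ A₀⁻¹ ∘ P_{y₀}‖ ≤ (4∕γ)·e^{r}·e^{−r·d_m(y₀,y₁)}`.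
HONEST SCOPE.  Composition; displayed: `γ` (Thm 3.11 via `B9Eq326WoodburySchur.local_coercive_of_coercive`), `p_K`, `β_K` ((3.69)-type sizes of `Δ′`), the
bond-averaging `Q(U)` conjugation letters; rate `r` = whatever the windows allow (a letter); nothing of [B9] Thm 3.1∕3.3∕3.11 asserted, valued or
discharged; «NE9 ⇐ the named binders»; NE9 NOT PRINTED ∕ NOT PROVED; row WALLED ON A MODEL (O-NE9-1; #5 UNRULED); spine PROVED 0∕9; rung (B)+1 on a finite
T⁴ — NOT infinite volume, NOT mass gap, NOT BetaPertH, NOT Clay.  HONEST DEPENDENCY: continuum YM on T⁴ ⇐ BetaPertH ∧ nine spine estimates (0/9 proved);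
BetaPertH ⇐ (D1) ∧ (D4) ∧ CAP+tail.  NEW file; nothing modified.  Net new unproved facts: 0.
-/

noncomputable section

set_option autoImplicit false

open scoped InnerProductSpace ComplexConjugate
open NormedSpace

namespace Literature.MathematicalPhysics.QuantumFieldTheory.Balaban1983to89.B9Eq326LocalPartBlockDecay

open B4Sect5Torus (TSite tdist)
open B9SectCLatticeCarrier (Bond bpos btgt)
open B9Eq311L2Pairing (WL2)
open B9Eq319QprimeTorus (fineP blockCoord)
open B7Prop1Explicit (U1)
open B11Eq103H1Complex (SiteL2K BondL2K greenK covDerivL2K covDivL2K)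
open B9Eq310HessianOperator (adTransportW PlaqL2K curvOp hessOp)
open B9Eq326ConjugatedLocalPart (norm_conjLocalInv_le)
open B9Eq3101ExpPointwiseMultiplier (equiv_exp_smul_apply_complex equiv_exp_smul_neg_apply_complex)
open B9Eq3101CommutatorCauchyBlockDecay (norm_block_le_of_conj_bound_abs)
open B9Eq349BlockMultipliers (mul_comp_block_eq_smul block_comp_mul_eq_smul opNorm_block_le)
open B9Eq349BlockDistanceWeight (exists_pairWeight)
open B9Eq387IMSLocalLettersLattice (exists_pointwise_clm)

/-! ## §1 The circle form of the conjugated-inverse bound -/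

section Circle

variable {d : ℕ} {Pd : Fin d → ℕ} {𝔸 : Type*} [NormedRing 𝔸] [StarRing 𝔸] [NormedAlgebra ℂ 𝔸] [StarModule ℂ 𝔸] [NormOneClass 𝔸]
  {W : Type*} [NormedAddCommGroup W] [InnerProductSpace ℂ W] [FiniteDimensional ℂ W] (φ : W ≃ₗ[ℂ] 𝔸) {Mφ Mφ' : ℝ}
  (hφ : ∀ w, ‖φ w‖ ≤ Mφ * ‖w‖) (hφ' : ∀ X, ‖φ.symm X‖ ≤ Mφ' * ‖X‖) (hMφ : 0 ≤ Mφ) (hMφ' : 0 ≤ Mφ')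
  {c₀ : ℝ} [Fact (0 < c₀)] {η : ℝ} (hη : 0 < η) (U : Bond d Pd → 𝔸ˣ) (hU : ∀ b, U b ∈ U1 𝔸)
  (hRS : ∀ (b : Bond d Pd) (v u : W), ⟪adTransportW φ U b v, u⟫_ℂ = ⟪v, adTransportW φ (fun b => (U b)⁻¹) b u⟫_ℂ)
  (τ : 𝔸 →ₗ[ℂ] ℂ) {F : Type*} [NormedAddCommGroup F] [InnerProductSpace ℂ F] [FiniteDimensional ℂ F]
  (Q : BondL2K ℂ d Pd c₀ W →ₗ[ℂ] F) (a : ℝ)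
  {χ : TSite d Pd → ℝ}
  {MB : BondL2K ℂ d Pd c₀ W →L[ℂ] BondL2K ℂ d Pd c₀ W}
  (hMB : ∀ (g : BondL2K ℂ d Pd c₀ W) (b : Bond d Pd),
    WL2.equiv ℂ (fun _ : Bond d Pd => c₀) W (MB g) b = (χ (bpos b) : ℂ) • WL2.equiv ℂ (fun _ : Bond d Pd => c₀) W g b)
  {MP : PlaqL2K ℂ d Pd c₀ W →L[ℂ] PlaqL2K ℂ d Pd c₀ W}
  (hMP : ∀ (g : PlaqL2K ℂ d Pd c₀ W) (p : B9SectCLatticeCarrier.Plaq d Pd),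
    WL2.equiv ℂ (fun _ : B9SectCLatticeCarrier.Plaq d Pd => c₀) W (MP g) p = (χ p.1 : ℂ) • WL2.equiv ℂ (fun _ : B9SectCLatticeCarrier.Plaq d Pd => c₀) W g p)
  {MS : SiteL2K ℂ d Pd c₀ W →L[ℂ] SiteL2K ℂ d Pd c₀ W}
  (hMS : ∀ (g : SiteL2K ℂ d Pd c₀ W) (x : TSite d Pd),
    WL2.equiv ℂ (fun _ : TSite d Pd => c₀) W (MS g) x = (χ x : ℂ) • WL2.equiv ℂ (fun _ : TSite d Pd => c₀) W g x)

include hφ hφ' hMφ hMφ' hη hU hRS hMB hMP hMS in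
/-- **THE CONJUGATED INVERSE OF THE LOCAL PART ON THE CIRCLE `‖κ‖ = r`**: `‖exp(κ•M_B) ∘ A₀⁻¹ ∘ exp(−κ•M_B)‖ ≤ 4∕γ` — `norm_conjLocalInv_le` at the
operator exponentials of the three multipliers (pointwise `e^{±κχ}` by (G)), radius windows, the conjugated `Q` ∕ `Δ′` letters displayed AT THIS `κ`.
[cite: Balaban1985BackgroundPropagators, (3.26) p.395, Thm 3.11 p.416, (3.49) p.399] -/
theorem norm_conjLocalInv_le_of_circle (ha : 0 ≤ a)
    (A₀ : BondL2K ℂ d Pd c₀ W →ₗ[ℂ] BondL2K ℂ d Pd c₀ W)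
    (hA₀ : A₀ = hessOp φ η U τ + covDerivL2K ℂ c₀ ((η : ℂ))⁻¹ (adTransportW φ U) ∘ₗ covDivL2K ℂ c₀ ((η : ℂ))⁻¹ (adTransportW φ fun b => (U b)⁻¹) +
      LinearMap.adjoint Q ∘ₗ ((a : ℂ) • Q))
    (hpos₀ : ∀ x : BondL2K ℂ d Pd c₀ W, x ≠ 0 → 0 < RCLike.re ⟪x, A₀ x⟫_ℂ)
    {γ β βK pK ℓ r : ℝ} (hγ : 0 < γ) (hβ : 0 ≤ β) (hℓ : 0 ≤ ℓ)
    (hcoer : ∀ f : BondL2K ℂ d Pd c₀ W, γ * ‖f‖ ^ 2 ≤ RCLike.re ⟪f, A₀ f⟫_ℂ)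
    (hKre : ∀ f : BondL2K ℂ d Pd c₀ W, -(pK * ‖f‖ ^ 2) ≤ RCLike.re ⟪f, curvOp φ τ η U f⟫_ℂ)
    (hχ : ∀ b : Bond d Pd, |χ (bpos b) - χ (btgt b)| ≤ ℓ * η) (hwin : r * ℓ * η ≤ 1)
    (hβCC : 4 * r * ℓ * (Mφ * Mφ') * (d * Real.sqrt d) ≤ β) (hβC : 4 * r * ℓ * (Mφ * Mφ') * d ≤ β)
    (hβD : 2 * r * ℓ * (Mφ * Mφ') * Real.sqrt d ≤ β)
    (hQK : ∀ κ : ℂ, ‖κ‖ = r →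
      (∃ (Qk : BondL2K ℂ d Pd c₀ W →ₗ[ℂ] F) (Qk' : F →ₗ[ℂ] BondL2K ℂ d Pd c₀ W),
        (∀ f, exp (κ • MB) (LinearMap.adjoint Q (((a : ℝ) : ℂ) • Q (exp (κ • (-MB)) f))) = ((a : ℝ) : ℂ) • Qk' (Qk f)) ∧
        (∀ f, ‖Qk f - Q f‖ ≤ β * ‖f‖) ∧ (∀ g, ‖Qk' g - LinearMap.adjoint Q g‖ ≤ β * ‖g‖)) ∧
      (∀ f, ‖exp (κ • MB) (curvOp φ τ η U (exp (κ • (-MB)) f)) - curvOp φ τ η U f‖ ≤ βK * ‖f‖))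
    (small : pK / 2 + 3 * (2 + a) * β ^ 2 + βK ≤ γ / 4) (κ : ℂ) (hκr : ‖κ‖ = r) :
    ‖exp (κ • MB) ∘L LinearMap.toContinuousLinearMap (greenK A₀ hpos₀) ∘L exp (κ • (-MB))‖ ≤ 4 / γ := by
  refine ContinuousLinearMap.opNorm_le_bound _ (by positivity) fun v => ?_
  -- the six multipliers at this `κ`, as linear maps with their pointwise actions
  have hS : ∀ (g : BondL2K ℂ d Pd c₀ W) (b : Bond d Pd),
      WL2.equiv ℂ (fun _ : Bond d Pd => c₀) W
          (((exp (κ • MB) : BondL2K ℂ d Pd c₀ W →L[ℂ] BondL2K ℂ d Pd c₀ W) : BondL2K ℂ d Pd c₀ W →ₗ[ℂ] BondL2K ℂ d Pd c₀ W) g) b =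
        Complex.exp (κ * (χ (bpos b) : ℂ)) • WL2.equiv ℂ (fun _ : Bond d Pd => c₀) W g b :=
    fun g b => equiv_exp_smul_apply_complex MB (fun b => χ (bpos b)) hMB κ g b
  have hSinv : ∀ (g : BondL2K ℂ d Pd c₀ W) (b : Bond d Pd),
      WL2.equiv ℂ (fun _ : Bond d Pd => c₀) W
          (((exp (κ • (-MB)) : BondL2K ℂ d Pd c₀ W →L[ℂ] BondL2K ℂ d Pd c₀ W) : BondL2K ℂ d Pd c₀ W →ₗ[ℂ] BondL2K ℂ d Pd c₀ W) g) b =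
        Complex.exp (-(κ * (χ (bpos b) : ℂ))) • WL2.equiv ℂ (fun _ : Bond d Pd => c₀) W g b :=
    fun g b => equiv_exp_smul_neg_apply_complex MB (fun b => χ (bpos b)) hMB κ g b
  have hSP : ∀ (g : PlaqL2K ℂ d Pd c₀ W) (p : B9SectCLatticeCarrier.Plaq d Pd),
      WL2.equiv ℂ (fun _ : B9SectCLatticeCarrier.Plaq d Pd => c₀) W
          (((exp (κ • MP) : PlaqL2K ℂ d Pd c₀ W →L[ℂ] PlaqL2K ℂ d Pd c₀ W) : PlaqL2K ℂ d Pd c₀ W →ₗ[ℂ] PlaqL2K ℂ d Pd c₀ W) g) p =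
        Complex.exp (κ * (χ p.1 : ℂ)) • WL2.equiv ℂ (fun _ : B9SectCLatticeCarrier.Plaq d Pd => c₀) W g p :=
    fun g p => equiv_exp_smul_apply_complex MP (fun p : B9SectCLatticeCarrier.Plaq d Pd => χ p.1) hMP κ g p
  have hSPinv : ∀ (g : PlaqL2K ℂ d Pd c₀ W) (p : B9SectCLatticeCarrier.Plaq d Pd),
      WL2.equiv ℂ (fun _ : B9SectCLatticeCarrier.Plaq d Pd => c₀) W
          (((exp (κ • (-MP)) : PlaqL2K ℂ d Pd c₀ W →L[ℂ] PlaqL2K ℂ d Pd c₀ W) : PlaqL2K ℂ d Pd c₀ W →ₗ[ℂ] PlaqL2K ℂ d Pd c₀ W) g) p =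
        Complex.exp (-(κ * (χ p.1 : ℂ))) • WL2.equiv ℂ (fun _ : B9SectCLatticeCarrier.Plaq d Pd => c₀) W g p :=
    fun g p => equiv_exp_smul_neg_apply_complex MP (fun p : B9SectCLatticeCarrier.Plaq d Pd => χ p.1) hMP κ g p
  have hSS : ∀ (g : SiteL2K ℂ d Pd c₀ W) (x : TSite d Pd),
      WL2.equiv ℂ (fun _ : TSite d Pd => c₀) W
          (((exp (κ • MS) : SiteL2K ℂ d Pd c₀ W →L[ℂ] SiteL2K ℂ d Pd c₀ W) : SiteL2K ℂ d Pd c₀ W →ₗ[ℂ] SiteL2K ℂ d Pd c₀ W) g) x =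
        Complex.exp (κ * (χ x : ℂ)) • WL2.equiv ℂ (fun _ : TSite d Pd => c₀) W g x :=
    fun g x => equiv_exp_smul_apply_complex MS χ hMS κ g x
  have hSSinv : ∀ (g : SiteL2K ℂ d Pd c₀ W) (x : TSite d Pd),
      WL2.equiv ℂ (fun _ : TSite d Pd => c₀) W
          (((exp (κ • (-MS)) : SiteL2K ℂ d Pd c₀ W →L[ℂ] SiteL2K ℂ d Pd c₀ W) : SiteL2K ℂ d Pd c₀ W →ₗ[ℂ] SiteL2K ℂ d Pd c₀ W) g) x =
        Complex.exp (-(κ * (χ x : ℂ))) • WL2.equiv ℂ (fun _ : TSite d Pd => c₀) W g x :=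
    fun g x => equiv_exp_smul_neg_apply_complex MS χ hMS κ g x
  -- the windows and the displayed letters at this `κ`
  have hwinκ : ‖κ‖ * ℓ * η ≤ 1 := by rw [hκr]; exact hwin
  have hβCC' : 4 * ‖κ‖ * ℓ * (Mφ * Mφ') * (d * Real.sqrt d) ≤ β := by rw [hκr]; exact hβCC
  have hβC' : 4 * ‖κ‖ * ℓ * (Mφ * Mφ') * d ≤ β := by rw [hκr]; exact hβC
  have hβD' : 2 * ‖κ‖ * ℓ * (Mφ * Mφ') * Real.sqrt d ≤ β := by rw [hκr]; exact hβD
  obtain ⟨⟨Qk, Qk', hQfac, dQ, dQ'⟩, dK⟩ := hQK κ hκr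
  have h := norm_conjLocalInv_le φ hφ hφ' hMφ hMφ' hη U hU hRS τ Q a
    (S := ((exp (κ • MB) : BondL2K ℂ d Pd c₀ W →L[ℂ] BondL2K ℂ d Pd c₀ W) : BondL2K ℂ d Pd c₀ W →ₗ[ℂ] BondL2K ℂ d Pd c₀ W))
    (Sinv := ((exp (κ • (-MB)) : BondL2K ℂ d Pd c₀ W →L[ℂ] BondL2K ℂ d Pd c₀ W) : BondL2K ℂ d Pd c₀ W →ₗ[ℂ] BondL2K ℂ d Pd c₀ W))
    hS hSinv hSP hSPinv hSS hSSinv ha A₀ hA₀ hpos₀ hγ hβ hℓ hcoer hKre hχ hwinκ hβCC' hβC' hβD' Qk Qk'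
    (fun f => by simpa only [ContinuousLinearMap.coe_coe] using hQfac f) dQ dQ'
    (fun f => by simpa only [LinearMap.comp_apply, ContinuousLinearMap.coe_coe] using dK f) small v
  simpa only [ContinuousLinearMap.comp_apply, LinearMap.coe_toContinuousLinearMap', LinearMap.comp_apply, ContinuousLinearMap.coe_coe] using h

end Circle

/-! ## §2 Block decay, bonds to bonds, from a circle letter uniform over weights -/

section Bonds

variable {d : ℕ} {L : ℕ} [NeZero L] {m : Fin d → ℕ} {c₀ : ℝ} [Fact (0 < c₀)]
  {W : Type*} [NormedAddCommGroup W] [InnerProductSpace ℂ W] [FiniteDimensional ℂ W]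

/-- **BLOCK DECAY, BONDS TO BONDS, FROM A UNIFORM CIRCLE LETTER** (twin of road B8″'s `norm_block_le_exp_of_uniform_circle_bound_sites`): `T : L²(bonds) →
L²(bonds)`, the bond blocks `P_y` (`π(b) = blockCoord(b₋)`), and ONE bound `C` on `‖e^{κM_B} ∘ T ∘ e^{−κM_B}‖` for every `‖κ‖ = r` and every site weight
`χ` with bond increments `≤ ι` (`1∕L ≤ ι`), `M_B` the bond multiplier by `χ(b₋)` ⟹ `‖P_{y₁} ∘ T ∘ P_{y₀}‖ ≤ C·e^{r}·e^{−r·d_m(y₀,y₁)}` — (K2)'s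
pair-adapted weight at `κ = ±r`, (K1)'s eigen-relations on the bond blocks, (A)'s Cauchy kernel. [folklore] (Combes–Thomas ∕ Agmon conjugation)
[cite: Balaban1985BackgroundPropagators, (3.49) p.399, Thm 3.11 p.416] -/
theorem norm_block_le_exp_of_uniform_circle_bound_bonds (hm : ∀ i, 1 ≤ m i)
    (T : BondL2K ℂ d (fineP L m) c₀ W →L[ℂ] BondL2K ℂ d (fineP L m) c₀ W)
    {PB : TSite d m → BondL2K ℂ d (fineP L m) c₀ W →L[ℂ] BondL2K ℂ d (fineP L m) c₀ W}
    (hPB : ∀ (y : TSite d m) (f : BondL2K ℂ d (fineP L m) c₀ W) (b : Bond d (fineP L m)),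
      WL2.equiv ℂ (fun _ : Bond d (fineP L m) => c₀) W (PB y f) b =
        if blockCoord L m (bpos b) = y then WL2.equiv ℂ (fun _ : Bond d (fineP L m) => c₀) W f b else 0)
    {r C ι : ℝ} (hr : 0 ≤ r) (hC0 : 0 ≤ C) (hι : 1 / (L : ℝ) ≤ ι)
    (hC : ∀ (χ : TSite d (fineP L m) → ℝ), (∀ b : Bond d (fineP L m), |χ (bpos b) - χ (btgt b)| ≤ ι) →
      ∀ (MB : BondL2K ℂ d (fineP L m) c₀ W →L[ℂ] BondL2K ℂ d (fineP L m) c₀ W),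
      (∀ (f : BondL2K ℂ d (fineP L m) c₀ W) (b : Bond d (fineP L m)),
        WL2.equiv ℂ (fun _ : Bond d (fineP L m) => c₀) W (MB f) b = (χ (bpos b) : ℂ) • WL2.equiv ℂ (fun _ : Bond d (fineP L m) => c₀) W f b) →
      ∀ κ : ℂ, ‖κ‖ = r → ‖exp (κ • MB) ∘L T ∘L exp (κ • (-MB))‖ ≤ C)
    (y₀ y₁ : TSite d m) :
    ‖PB y₁ ∘L T ∘L PB y₀‖ ≤ C * Real.exp r * Real.exp (-(r * tdist m y₀ y₁)) := by
  obtain ⟨χ, hχ0, hχA, hχB, hχbond, hχblock, hχcentre, hDlo, hDhi⟩ := exists_pairWeight (L := L) hm y₀ y₁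
  set D : ℝ := max 0 ((L : ℝ) * tdist m y₀ y₁ - ((L : ℝ) - 1)) with hD
  obtain ⟨MB, hMB⟩ := exists_pointwise_clm (𝕜 := ℂ) (w := fun _ : Bond d (fineP L m) => c₀) (V := W) (fun b : Bond d (fineP L m) => bpos b) χ
  have hCχ := hC χ (fun b => (hχbond b).trans hι) MB hMB
  have hκp : ‖((r : ℝ) : ℂ)‖ = r := by rw [Complex.norm_real, Real.norm_eq_abs, abs_of_nonneg hr]
  have hκm : ‖((-r : ℝ) : ℂ)‖ = r := by rw [Complex.norm_real, Real.norm_eq_abs, abs_neg, abs_of_nonneg hr]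
  have hp : MB ∘L PB y₀ = (((0 : ℝ) : ℂ)) • PB y₀ :=
    mul_comp_block_eq_smul (π := fun b : Bond d (fineP L m) => blockCoord L m (bpos b)) hPB hMB y₀ _ fun b hb => by
      rw [hχA (bpos b) hb]; simp
  have hq : PB y₁ ∘L MB = (((D / L : ℝ)) : ℂ) • PB y₁ :=
    block_comp_mul_eq_smul (π := fun b : Bond d (fineP L m) => blockCoord L m (bpos b)) hPB hMB y₁ _ fun b hb => by
      rw [hχB (bpos b) hb]; rfl
  have h := norm_block_le_of_conj_bound_abs MB MB T (PB y₀) (PB y₁) 0 (D / L) r hp hq (hCχ _ hκp) (hCχ _ hκm)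
  have hDL : 0 ≤ D / L := div_nonneg (le_max_left _ _) (Nat.cast_nonneg _)
  rw [sub_zero, abs_of_nonneg hDL] at h
  have h1 : ‖PB y₁ ∘L T ∘L PB y₀‖ ≤ Real.exp (-(r * (D / L))) * C := by
    refine h.trans (mul_le_mul_of_nonneg_left ?_ (Real.exp_pos _).le)
    calc ‖PB y₁‖ * C * ‖PB y₀‖ ≤ 1 * C * 1 := by
          gcongr
          · exact opNorm_block_le hPB y₁
          · exact opNorm_block_le hPB y₀
      _ = C := by ring
  refine h1.trans ?_
  rw [mul_comm, mul_assoc, ← Real.exp_add]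
  refine mul_le_mul_of_nonneg_left (Real.exp_le_exp.mpr ?_) hC0
  have hDL' : tdist m y₀ y₁ - 1 ≤ D / L := hDlo
  nlinarith

end Bonds

/-! ## §3 The instance: block decay of `A₀⁻¹` on the one-step torus -/

section Instance

variable {d : ℕ} {L : ℕ} [NeZero L] {m : Fin d → ℕ} {𝔸 : Type*} [NormedRing 𝔸] [StarRing 𝔸] [NormedAlgebra ℂ 𝔸] [StarModule ℂ 𝔸] [NormOneClass 𝔸]
  {W : Type*} [NormedAddCommGroup W] [InnerProductSpace ℂ W] [FiniteDimensional ℂ W] (φ : W ≃ₗ[ℂ] 𝔸) {Mφ Mφ' : ℝ}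
  (hφ : ∀ w, ‖φ w‖ ≤ Mφ * ‖w‖) (hφ' : ∀ X, ‖φ.symm X‖ ≤ Mφ' * ‖X‖) (hMφ : 0 ≤ Mφ) (hMφ' : 0 ≤ Mφ')
  {c₀ : ℝ} [Fact (0 < c₀)] {η : ℝ} (hη : 0 < η) (hηL : η * L = 1) (U : Bond d (fineP L m) → 𝔸ˣ) (hU : ∀ b, U b ∈ U1 𝔸)
  (hRS : ∀ (b : Bond d (fineP L m)) (v u : W), ⟪adTransportW φ U b v, u⟫_ℂ = ⟪v, adTransportW φ (fun b => (U b)⁻¹) b u⟫_ℂ)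
  (τ : 𝔸 →ₗ[ℂ] ℂ) {F : Type*} [NormedAddCommGroup F] [InnerProductSpace ℂ F] [FiniteDimensional ℂ F]
  (Q : BondL2K ℂ d (fineP L m) c₀ W →ₗ[ℂ] F) (a : ℝ)

include hφ hφ' hMφ hMφ' hη hηL hU hRS in
/-- **THE `L²` BLOCK DECAY OF `A₀⁻¹`**: on the one-step torus at the diagonal `ηL = 1`, for the local part `A₀ = Δ(U) + D_UD*_U + Q†(a•Q)` of every
background with `U(b) ∈ U1` and mutually adjoint transports, given its `γ`-coercivity (Thm 3.11), the `Δ′` floor `p_K`, the radius windows (`1 ≤ ℓ`,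
`rℓη ≤ 1`, `4rℓM_φM_φ′d√d ≤ β`, `4rℓM_φM_φ′d ≤ β`, `2rℓM_φM_φ′√d ≤ β`, `p_K∕2 + 3(2+a)β² + β_K ≤ γ∕4`) and the conjugated `Q` ∕ `Δ′` letters UNIFORMLY over
the site weights with bond increments `≤ ℓη` and the circle `‖κ‖ = r` (displayed): for every bond-block family and every pair of coarse sites
`‖P_{y₁} ∘ A₀⁻¹ ∘ P_{y₀}‖ ≤ (4∕γ)·e^{r}·e^{−r·d_m(y₀,y₁)}`. [cite: Balaban1985BackgroundPropagators, (3.26) p.395, Thm 3.11 p.416, (3.49) p.399] -/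
theorem norm_block_localInv_le (ha : 0 ≤ a) (hm : ∀ i, 1 ≤ m i) (hL : 1 ≤ L)
    (A₀ : BondL2K ℂ d (fineP L m) c₀ W →ₗ[ℂ] BondL2K ℂ d (fineP L m) c₀ W)
    (hA₀ : A₀ = hessOp φ η U τ + covDerivL2K ℂ c₀ ((η : ℂ))⁻¹ (adTransportW φ U) ∘ₗ covDivL2K ℂ c₀ ((η : ℂ))⁻¹ (adTransportW φ fun b => (U b)⁻¹) +
      LinearMap.adjoint Q ∘ₗ ((a : ℂ) • Q))
    (hpos₀ : ∀ x : BondL2K ℂ d (fineP L m) c₀ W, x ≠ 0 → 0 < RCLike.re ⟪x, A₀ x⟫_ℂ)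
    {γ β βK pK ℓ r : ℝ} (hγ : 0 < γ) (hβ : 0 ≤ β) (hℓ : 1 ≤ ℓ) (hr : 0 ≤ r)
    (hcoer : ∀ f : BondL2K ℂ d (fineP L m) c₀ W, γ * ‖f‖ ^ 2 ≤ RCLike.re ⟪f, A₀ f⟫_ℂ)
    (hKre : ∀ f : BondL2K ℂ d (fineP L m) c₀ W, -(pK * ‖f‖ ^ 2) ≤ RCLike.re ⟪f, curvOp φ τ η U f⟫_ℂ)
    (hwin : r * ℓ * η ≤ 1)
    (hβCC : 4 * r * ℓ * (Mφ * Mφ') * (d * Real.sqrt d) ≤ β) (hβC : 4 * r * ℓ * (Mφ * Mφ') * d ≤ β)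
    (hβD : 2 * r * ℓ * (Mφ * Mφ') * Real.sqrt d ≤ β)
    (hQK : ∀ (χ : TSite d (fineP L m) → ℝ), (∀ b : Bond d (fineP L m), |χ (bpos b) - χ (btgt b)| ≤ ℓ * η) →
      ∀ (MB : BondL2K ℂ d (fineP L m) c₀ W →L[ℂ] BondL2K ℂ d (fineP L m) c₀ W),
      (∀ (g : BondL2K ℂ d (fineP L m) c₀ W) (b : Bond d (fineP L m)),
        WL2.equiv ℂ (fun _ : Bond d (fineP L m) => c₀) W (MB g) b = (χ (bpos b) : ℂ) • WL2.equiv ℂ (fun _ : Bond d (fineP L m) => c₀) W g b) →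
      ∀ κ : ℂ, ‖κ‖ = r →
      (∃ (Qk : BondL2K ℂ d (fineP L m) c₀ W →ₗ[ℂ] F) (Qk' : F →ₗ[ℂ] BondL2K ℂ d (fineP L m) c₀ W),
        (∀ f, exp (κ • MB) (LinearMap.adjoint Q (((a : ℝ) : ℂ) • Q (exp (κ • (-MB)) f))) = ((a : ℝ) : ℂ) • Qk' (Qk f)) ∧
        (∀ f, ‖Qk f - Q f‖ ≤ β * ‖f‖) ∧ (∀ g, ‖Qk' g - LinearMap.adjoint Q g‖ ≤ β * ‖g‖)) ∧
      (∀ f, ‖exp (κ • MB) (curvOp φ τ η U (exp (κ • (-MB)) f)) - curvOp φ τ η U f‖ ≤ βK * ‖f‖))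
    (small : pK / 2 + 3 * (2 + a) * β ^ 2 + βK ≤ γ / 4)
    (PB : TSite d m → BondL2K ℂ d (fineP L m) c₀ W →L[ℂ] BondL2K ℂ d (fineP L m) c₀ W)
    (hPB : ∀ (y : TSite d m) (f : BondL2K ℂ d (fineP L m) c₀ W) (b : Bond d (fineP L m)),
      WL2.equiv ℂ (fun _ : Bond d (fineP L m) => c₀) W (PB y f) b =
        if blockCoord L m (bpos b) = y then WL2.equiv ℂ (fun _ : Bond d (fineP L m) => c₀) W f b else 0)
    (y₀ y₁ : TSite d m) :
    ‖PB y₁ ∘L LinearMap.toContinuousLinearMap (greenK A₀ hpos₀) ∘L PB y₀‖ ≤ 4 / γ * Real.exp r * Real.exp (-(r * tdist m y₀ y₁)) := by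
  have hL0 : (0 : ℝ) < L := by exact_mod_cast (show 0 < L by omega)
  have hι : 1 / (L : ℝ) ≤ ℓ * η := by
    rw [div_le_iff₀ hL0]
    calc (1 : ℝ) = 1 * (η * L) := by rw [hηL, mul_one]
      _ ≤ ℓ * (η * L) := by gcongr
      _ = ℓ * η * L := by ring
  refine norm_block_le_exp_of_uniform_circle_bound_bonds hm _ hPB hr (by positivity) hι (fun χ hχ MB hMB κ hκr => ?_) y₀ y₁
  -- the plaquette and site multipliers of this weight, then §1
  obtain ⟨MP, hMP⟩ := exists_pointwise_clm (𝕜 := ℂ) (w := fun _ : B9SectCLatticeCarrier.Plaq d (fineP L m) => c₀) (V := W)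
    (fun p : B9SectCLatticeCarrier.Plaq d (fineP L m) => p.1) χ
  obtain ⟨MS, hMS⟩ := exists_pointwise_clm (𝕜 := ℂ) (w := fun _ : TSite d (fineP L m) => c₀) (V := W) (fun x : TSite d (fineP L m) => x) χ
  exact norm_conjLocalInv_le_of_circle φ hφ hφ' hMφ hMφ' hη U hU hRS τ Q a hMB hMP hMS ha A₀ hA₀ hpos₀ hγ hβ (zero_le_one.trans hℓ) hcoer hKre
    hχ hwin hβCC hβC hβD (hQK χ hχ MB hMB) small κ hκr

end Instance

end Literature.MathematicalPhysics.QuantumFieldTheory.Balaban1983to89.B9Eq326LocalPartBlockDecay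

end
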